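import Summits.AtomisticToContinuum.Crystallization.Theorems.ChessboardParticlePlanesPeriodicWindowsEnvelopeDefs

/-!
# Envelope numerics for `PeriodicWindows` (stmt-AtomisticToContinuum-3240), stub E2b — terms, squares and the one-layer tail

Elementary facts about the pattern terms `envTerm d lo bdd e t v = [v admissible] (Q_d(i,j) + k² t)^{-e}`
(definitions in `…EnvelopeDefs`): positivity of `Q_d + k² t` off the origin, the shell bound
`Q_d ≥ (3/5) m²` when `|i| ≥ m ≥ 4` or `|j| ≥ m ≥ 4`, antitonicity in `t`; then the ONE-LAYER tail: the
squares `{l} × [-m,m]²`, their shells (`8m` sites, each term `≤ ((3/5)m²)^{-e}`), and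
`∑_{s} term ≤ ∑_{envBox lo 1 K} term + envTail2 e K` for every finite `s` and every one-layer pattern
`(lo, true)`, `e ≥ 3`, `K ≥ 4`, `t ≥ 0`.  The anisotropic cube tail for the unbounded patterns is in
`…EnvelopeTail3`.  [folklore]
-/

noncomputable section

namespace Summit.AtomisticToContinuum.Crystallization.Theorems.PeriodicWindowsSketch

open Finset Summit.AtomisticToContinuum.Crystallization.Theorems.ExcessDecayLiouvilleCoarseGrains

/-! ## The form and the terms -/

/-- `Q₁(i,j) = i² + ij + j² + i + j + 1/3 ≥ 1/12 > 0` on integers (indeed `≥ 1/3`): positivity of the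
shifted form. [folklore] -/
theorem env_Q_one_pos (i j : ℤ) : 0 < hcpSumQ ((1 : ℤ), i, j) := by
  have h := hcpSumQ_ge_sq_fst (1 : ℤ) i j
  rw [if_neg (by decide)] at h
  have hne : (i : ℝ) + 1 / 3 ≠ 0 := by
    intro h0
    have h1 : (3 * i + 1 : ℤ) = 0 := by
      have : (3 : ℝ) * i + 1 = 0 := by linarith
      exact_mod_cast this
    omega
  have : 0 < ((i : ℝ) + 1 / 3) ^ 2 := by positivity
  linarith

/-- **Positivity**: `Q_d(i,j) + k² t > 0` for `(k,i,j) ≠ 0`, `d ∈ {0,1}`, `t > 0`. [folklore] -/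
theorem env_r_pos {d : ℕ} (hd : d = 0 ∨ d = 1) {k i j : ℤ} (hv : ((k, i, j) : ℤ × ℤ × ℤ) ≠ 0) {t : ℝ}
    (ht : 0 < t) : 0 < hcpSumQ ((d : ℤ), i, j) + (k : ℝ) ^ 2 * t := by
  have hQ := hcpSumQ_nonneg ((d : ℤ), i, j)
  by_cases hk : k = 0
  · subst hk
    have hij : (i, j) ≠ (0, 0) := by
      rintro hij
      simp only [Prod.mk.injEq] at hij
      obtain ⟨rfl, rfl⟩ := hij
      exact hv rfl
    rcases hd with rfl | rfl
    · have h1 := hcpSum_one_le_form hij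
      rw [Nat.cast_zero, hcpSumQ_even (show Even (0 : ℤ) from ⟨0, rfl⟩)]
      push_cast
      nlinarith
    · have h1 := env_Q_one_pos i j
      push_cast at h1 ⊢
      nlinarith
  · have : 0 < (k : ℝ) ^ 2 * t := by
      have hk' : (k : ℝ) ≠ 0 := by exact_mod_cast hk
      positivity
    linarith

/-- The terms vanish off the admissible set. [folklore] -/
theorem envTerm_of_not {d lo : ℕ} {bdd : Bool} {e : ℕ} {t : ℝ} {v : ℤ × ℤ × ℤ}
    (h : ¬ ((lo : ℤ) ≤ v.1 ∧ (bdd = true → v.1 ≤ lo) ∧ v ≠ 0)) : envTerm d lo bdd e t v = 0 := by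
  unfold envTerm; rw [if_neg h]

/-- The terms on the admissible set. [folklore] -/
theorem envTerm_of {d lo : ℕ} {bdd : Bool} {e : ℕ} {t : ℝ} {v : ℤ × ℤ × ℤ}
    (h : (lo : ℤ) ≤ v.1 ∧ (bdd = true → v.1 ≤ lo) ∧ v ≠ 0) :
    envTerm d lo bdd e t v = ((hcpSumQ ((d : ℤ), v.2.1, v.2.2) + (v.1 : ℝ) ^ 2 * t)⁻¹) ^ e := by
  unfold envTerm; rw [if_pos h]

/-- Every term is at most the full term `((Q_d + k²t)⁻¹)^e` (for `t ≥ 0`). [folklore] -/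
theorem envTerm_le_full (d lo : ℕ) (bdd : Bool) (e : ℕ) {t : ℝ} (ht : 0 ≤ t) (v : ℤ × ℤ × ℤ) :
    envTerm d lo bdd e t v ≤ ((hcpSumQ ((d : ℤ), v.2.1, v.2.2) + (v.1 : ℝ) ^ 2 * t)⁻¹) ^ e := by
  have hQ := hcpSumQ_nonneg ((d : ℤ), v.2.1, v.2.2)
  unfold envTerm
  split_ifs
  · exact le_rfl
  · positivity

/-- If `Q_d + k² t ≥ x > 0` then the term is `≤ (x⁻¹)^e`. [folklore] -/
theorem envTerm_le_of_le {d lo : ℕ} {bdd : Bool} {e : ℕ} {t : ℝ} (ht : 0 ≤ t) {v : ℤ × ℤ × ℤ} {x : ℝ}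
    (hx : 0 < x) (h : x ≤ hcpSumQ ((d : ℤ), v.2.1, v.2.2) + (v.1 : ℝ) ^ 2 * t) :
    envTerm d lo bdd e t v ≤ (x⁻¹) ^ e := by
  refine (envTerm_le_full d lo bdd e ht v).trans ?_
  have hQ := hcpSumQ_nonneg ((d : ℤ), v.2.1, v.2.2)
  exact pow_le_pow_left₀ (by positivity) (inv_anti₀ hx h) e

/-- The terms are antitone in `t > 0` (`d ∈ {0,1}`). [folklore] -/
theorem envTerm_antitone {d : ℕ} (hd : d = 0 ∨ d = 1) (lo : ℕ) (bdd : Bool) (e : ℕ) {t₁ t₂ : ℝ}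
    (h₁ : 0 < t₁) (h₁₂ : t₁ ≤ t₂) (v : ℤ × ℤ × ℤ) : envTerm d lo bdd e t₂ v ≤ envTerm d lo bdd e t₁ v := by
  unfold envTerm
  split_ifs with hv
  · obtain ⟨k, i, j⟩ := v
    have hr := env_r_pos hd hv.2.2 h₁
    have hQ := hcpSumQ_nonneg ((d : ℤ), i, j)
    dsimp only at hr ⊢
    have h2 : 0 ≤ (hcpSumQ ((d : ℤ), i, j) + (k : ℝ) ^ 2 * t₂)⁻¹ := by
      rw [inv_nonneg]; nlinarith [sq_nonneg (k : ℝ)]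
    refine pow_le_pow_left₀ h2 (inv_anti₀ hr ?_) e
    nlinarith [sq_nonneg (k : ℝ)]
  · exact le_rfl

/-- **Shell bound for the form**: `|i| ≥ m ≥ 4` gives `Q_d ≥ (3/5) m²`. [folklore] -/
theorem env_Q_ge_of_fst (d : ℤ) {i j : ℤ} {m : ℕ} (hm : 4 ≤ m) (hi : (m : ℤ) ≤ |i|) :
    3 / 5 * (m : ℝ) ^ 2 ≤ hcpSumQ (d, i, j) := by
  have h := hcpSumQ_ge_of_le_abs_fst (k := d) (j := j) (by omega) hi
  have hm4 : (4 : ℝ) ≤ m := by exact_mod_cast hm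
  nlinarith

/-- **Shell bound for the form**: `|j| ≥ m ≥ 4` gives `Q_d ≥ (3/5) m²`. [folklore] -/
theorem env_Q_ge_of_snd (d : ℤ) {i j : ℤ} {m : ℕ} (hm : 4 ≤ m) (hj : (m : ℤ) ≤ |j|) :
    3 / 5 * (m : ℝ) ^ 2 ≤ hcpSumQ (d, i, j) := by
  have h := hcpSumQ_ge_of_le_abs_snd (k := d) (i := i) (by omega) hj
  have hm4 : (4 : ℝ) ≤ m := by exact_mod_cast hm
  nlinarith

/-! ## Squares of one layer and the one-layer tail -/

/-- Membership in a layer square. [folklore] -/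
theorem env_mem_envSq {l : ℤ} {m : ℕ} {v : ℤ × ℤ × ℤ} :
    v ∈ envSq l m ↔ v.1 = l ∧ |v.2.1| ≤ m ∧ |v.2.2| ≤ m := by
  obtain ⟨k, i, j⟩ := v
  simp only [envSq, Finset.mem_product, Finset.mem_singleton, Finset.mem_Icc, abs_le]

/-- The squares increase. [folklore] -/
theorem envSq_mono (l : ℤ) {m m' : ℕ} (h : m ≤ m') : envSq l m ⊆ envSq l m' := by
  intro v hv
  rw [env_mem_envSq] at hv ⊢
  have : (m : ℤ) ≤ m' := by exact_mod_cast h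
  exact ⟨hv.1, hv.2.1.trans this, hv.2.2.trans this⟩

/-- `#({l} × [-m,m]²) = (2m+1)²`. [folklore] -/
theorem env_card_envSq (l : ℤ) (m : ℕ) : (envSq l m).card = (2 * m + 1) ^ 2 := by
  simp only [envSq, Finset.card_product, Finset.card_singleton, Int.card_Icc]
  have : ((m : ℤ) + 1 - -(m : ℤ)).toNat = 2 * m + 1 := by omega
  rw [this]; ring

/-- A square shell has `8m` sites. [folklore] -/
theorem env_card_sqShell (l : ℤ) {m : ℕ} (hm : 1 ≤ m) :
    ((envSq l m \ envSq l (m - 1)).card : ℝ) = 8 * (m : ℝ) := by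
  rw [Finset.card_sdiff_of_subset (envSq_mono l (Nat.sub_le m 1)), env_card_envSq, env_card_envSq]
  obtain ⟨n, rfl⟩ : ∃ n, m = n + 1 := ⟨m - 1, by omega⟩
  simp only [Nat.add_sub_cancel]
  have h : (2 * n + 1) ^ 2 ≤ (2 * (n + 1) + 1) ^ 2 := Nat.pow_le_pow_left (by omega) 2
  have : (2 * (n + 1) + 1) ^ 2 - (2 * n + 1) ^ 2 = 8 * (n + 1) := by
    zify [h]; ring
  rw [this]; push_cast; ring

/-- Outside a square some in-plane coordinate is large. [folklore] -/
theorem env_not_mem_envSq {l : ℤ} {m : ℕ} {v : ℤ × ℤ × ℤ} (hv : v.1 = l) :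
    v ∉ envSq l m ↔ (m : ℤ) + 1 ≤ |v.2.1| ∨ (m : ℤ) + 1 ≤ |v.2.2| := by
  rw [env_mem_envSq]; omega

/-- **Sum over one square shell**: for `m ≥ 4`, `t ≥ 0`,
`∑_{shell m} term ≤ 8m ((3/5)m²)^{-e}`. [folklore] -/
theorem env_sum_sqShell_le (d lo : ℕ) (bdd : Bool) (e : ℕ) {t : ℝ} (ht : 0 ≤ t) (l : ℤ) {m : ℕ} (hm : 4 ≤ m) :
    ∑ v ∈ envSq l m \ envSq l (m - 1), envTerm d lo bdd e t v ≤
      8 * (m : ℝ) * ((3 / 5 * (m : ℝ) ^ 2)⁻¹) ^ e := by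
  have hm0 : (0 : ℝ) < 3 / 5 * (m : ℝ) ^ 2 := by
    have : (4 : ℝ) ≤ m := by exact_mod_cast hm
    positivity
  have hbound : ∀ v ∈ envSq l m \ envSq l (m - 1), envTerm d lo bdd e t v ≤ ((3 / 5 * (m : ℝ) ^ 2)⁻¹) ^ e := by
    intro v hv
    rw [Finset.mem_sdiff] at hv
    have hl : v.1 = l := (env_mem_envSq.1 hv.1).1
    have hout := (env_not_mem_envSq (m := m - 1) hl).1 hv.2
    have h1 : ((m - 1 : ℕ) : ℤ) + 1 = m := by omega
    rw [h1] at hout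
    apply envTerm_le_of_le ht hm0
    have hk : 0 ≤ (v.1 : ℝ) ^ 2 * t := by positivity
    rcases hout with hi | hj
    · have := env_Q_ge_of_fst (d : ℤ) (j := v.2.2) hm hi
      linarith
    · have := env_Q_ge_of_snd (d : ℤ) (i := v.2.1) hm hj
      linarith
  calc ∑ v ∈ envSq l m \ envSq l (m - 1), envTerm d lo bdd e t v
      ≤ ∑ _v ∈ envSq l m \ envSq l (m - 1), ((3 / 5 * (m : ℝ) ^ 2)⁻¹) ^ e := Finset.sum_le_sum hbound
    _ = 8 * (m : ℝ) * ((3 / 5 * (m : ℝ) ^ 2)⁻¹) ^ e := by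
        rw [Finset.sum_const, nsmul_eq_mul, env_card_sqShell l (by omega)]

/-- The square-shell bound in telescopable form: for `e ≥ 3`, `m ≥ K+1 ≥ 2`,
`8m ((3/5)m²)^{-e} ≤ 8 (5/3)ᵉ / ((K+1)^{2e-5} m⁴)`. [folklore] -/
theorem env_sqShell_bound_le {e K m : ℕ} (he : 3 ≤ e) (hK : 1 ≤ K) (hm : K + 1 ≤ m) :
    8 * (m : ℝ) * ((3 / 5 * (m : ℝ) ^ 2)⁻¹) ^ e ≤
      8 * (5 / 3 : ℝ) ^ e / ((K : ℝ) + 1) ^ (2 * e - 5) * ((m : ℝ) ^ 4)⁻¹ := by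
  have hm2 : (2 : ℝ) ≤ m := by exact_mod_cast (show 2 ≤ m by omega)
  have hm0 : (0 : ℝ) < m := by linarith
  have hKm : (K : ℝ) + 1 ≤ m := by exact_mod_cast hm
  obtain ⟨d, rfl⟩ : ∃ d, e = d + 3 := ⟨e - 3, by omega⟩
  have h26 : 2 * (d + 3) - 5 = 2 * d + 1 := by omega
  rw [h26]
  have hl : 8 * (m : ℝ) * ((3 / 5 * (m : ℝ) ^ 2)⁻¹) ^ (d + 3) =
      8 * (5 / 3) ^ (d + 3) / ((m : ℝ) ^ (2 * d + 1) * (m : ℝ) ^ 4) := by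
    rw [show ((3 : ℝ) / 5 * (m : ℝ) ^ 2)⁻¹ = 5 / 3 * ((m : ℝ) ^ 2)⁻¹ by rw [mul_inv]; norm_num,
      mul_pow, inv_pow]
    have : ((m : ℝ) ^ 2) ^ (d + 3) = (m : ℝ) ^ (2 * d + 1) * (m : ℝ) ^ 4 * m := by ring
    rw [this]
    field_simp
  have hr : 8 * (5 / 3 : ℝ) ^ (d + 3) / ((K : ℝ) + 1) ^ (2 * d + 1) * ((m : ℝ) ^ 4)⁻¹ =
      8 * (5 / 3 : ℝ) ^ (d + 3) / (((K : ℝ) + 1) ^ (2 * d + 1) * (m : ℝ) ^ 4) := by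
    rw [div_mul_eq_mul_div]
    field_simp
  rw [hl, hr]
  have h1 : ((K : ℝ) + 1) ^ (2 * d + 1) ≤ (m : ℝ) ^ (2 * d + 1) := pow_le_pow_left₀ (by positivity) hKm _
  have hpos : (0 : ℝ) < ((K : ℝ) + 1) ^ (2 * d + 1) * (m : ℝ) ^ 4 := by positivity
  exact div_le_div_of_nonneg_left (by positivity) hpos (mul_le_mul_of_nonneg_right h1 (by positivity))

/-- **Square differences are below the one-layer tail**: for `e ≥ 3`, `K ≥ 4`, `t ≥ 0` and every
`K' ≥ K`, `∑_{sq K' ∖ sq K} term ≤ envTail2 e K`. [folklore] -/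
theorem env_sum_sdiff_envSq_le (d lo : ℕ) (bdd : Bool) {e : ℕ} (he : 3 ≤ e) {t : ℝ} (ht : 0 ≤ t) (l : ℤ)
    {K K' : ℕ} (hK : 4 ≤ K) (h : K ≤ K') :
    ∑ v ∈ envSq l K' \ envSq l K, envTerm d lo bdd e t v ≤ envTail2 e K := by
  have main : ∑ v ∈ envSq l K' \ envSq l K, envTerm d lo bdd e t v ≤
      8 * (5 / 3 : ℝ) ^ e / ((K : ℝ) + 1) ^ (2 * e - 5) * ∑ m ∈ Finset.Ioc K K', ((m : ℝ) ^ 4)⁻¹ := by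
    induction K', h using Nat.le_induction with
    | base => simp
    | succ K' hKK' ih =>
      have hsplit : envSq l (K' + 1) \ envSq l K =
          (envSq l (K' + 1) \ envSq l K') ∪ (envSq l K' \ envSq l K) :=
        (Finset.sdiff_union_sdiff_cancel (envSq_mono l (Nat.le_succ K')) (envSq_mono l hKK')).symm
      have hdisj : Disjoint (envSq l (K' + 1) \ envSq l K') (envSq l K' \ envSq l K) :=
        Finset.disjoint_left.2 fun v h1 h2 => (Finset.mem_sdiff.1 h1).2 (Finset.mem_sdiff.1 h2).1
      rw [hsplit, Finset.sum_union hdisj, Finset.sum_Ioc_succ_top hKK', mul_add]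
      have hshell := env_sum_sqShell_le d lo bdd e ht l (m := K' + 1) (by omega)
      rw [show K' + 1 - 1 = K' from rfl] at hshell
      have hsb := env_sqShell_bound_le (e := e) (K := K) (m := K' + 1) he (by omega) (by omega)
      push_cast at hshell hsb ⊢
      linarith
  refine main.trans ?_
  have htel := hcpSum_sum_Ioc_inv_pow_four_le (K := K) (K' := K') (by omega) h
  have hpos : 0 ≤ 8 * (5 / 3 : ℝ) ^ e / ((K : ℝ) + 1) ^ (2 * e - 5) := by positivity
  have hK3 : (3 : ℝ) ≤ K := by exact_mod_cast (show 3 ≤ K by omega)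
  have hK'3 : (3 : ℝ) ≤ K' := by exact_mod_cast (show 3 ≤ K' by omega)
  have hdrop : 1 / 3 * (1 / ((K : ℝ) * (K - 1) * (K - 2)) - 1 / ((K' : ℝ) * (K' - 1) * (K' - 2))) ≤
      1 / 3 / ((K : ℝ) * (K - 1) * (K - 2)) := by
    have : 0 ≤ 1 / ((K' : ℝ) * (K' - 1) * (K' - 2)) := by
      have : (0:ℝ) < K' - 2 := by linarith
      have : (0:ℝ) < K' - 1 := by linarith
      positivity
    have e1 : (1:ℝ) / 3 / ((K : ℝ) * (K - 1) * (K - 2)) = 1 / 3 * (1 / ((K : ℝ) * (K - 1) * (K - 2))) := by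
      ring
    linarith
  calc 8 * (5 / 3 : ℝ) ^ e / ((K : ℝ) + 1) ^ (2 * e - 5) * ∑ m ∈ Finset.Ioc K K', ((m : ℝ) ^ 4)⁻¹
      ≤ 8 * (5 / 3 : ℝ) ^ e / ((K : ℝ) + 1) ^ (2 * e - 5) * (1 / 3 / ((K : ℝ) * (K - 1) * (K - 2))) :=
        mul_le_mul_of_nonneg_left (htel.trans hdrop) hpos
    _ = envTail2 e K := by unfold envTail2; ring

/-- The one-layer box is the layer square: `envBox lo 1 K = envSq lo K`. [folklore] -/
theorem envBox_one (lo K : ℕ) : envBox lo 1 K = envSq (lo : ℤ) K := by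
  unfold envBox envSq
  congr 1

/-- A finite set of sites lies in some cube `hcpSumCube K'`, hence its layer-`l` part in `envSq l K'`.
[folklore] -/
theorem env_filter_subset_envSq (s : Finset (ℤ × ℤ × ℤ)) (l : ℤ) (K₀ : ℕ) :
    ∃ K', K₀ ≤ K' ∧ s.filter (fun v : ℤ × ℤ × ℤ => v.1 = l) ⊆ envSq l K' := by
  obtain ⟨K', hK', hs⟩ := hcpSum_exists_subset_hcpSumCube s K₀
  refine ⟨K', hK', fun v hv => ?_⟩
  rw [Finset.mem_filter] at hv
  have h := hcpSum_mem_hcpSumCube.1 (hs hv.1)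
  exact env_mem_envSq.2 ⟨hv.2, h.2.1, h.2.2⟩

/-- **Finite sums of a one-layer pattern are bounded by box + tail**: for `e ≥ 3`, `K ≥ 4`, `t ≥ 0`
and every finite `s ⊆ ℤ³`, `∑_s term ≤ ∑_{envBox lo 1 K} term + envTail2 e K`. [folklore] -/
theorem env_thin_sum_le (d lo : ℕ) {e : ℕ} (he : 3 ≤ e) {t : ℝ} (ht : 0 ≤ t) {K : ℕ} (hK : 4 ≤ K)
    (s : Finset (ℤ × ℤ × ℤ)) :
    ∑ v ∈ s, envTerm d lo true e t v ≤ ∑ v ∈ envBox lo 1 K, envTerm d lo true e t v + envTail2 e K := by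
  obtain ⟨K', hKK', hs⟩ := env_filter_subset_envSq s (lo : ℤ) K
  have h0 : ∑ v ∈ s, envTerm d lo true e t v =
      ∑ v ∈ s.filter (fun v : ℤ × ℤ × ℤ => v.1 = (lo : ℤ)), envTerm d lo true e t v := by
    rw [Finset.sum_filter]
    refine Finset.sum_congr rfl fun v _ => ?_
    split_ifs with hv
    · rfl
    · exact envTerm_of_not fun h => hv ((envAdm_true_iff lo v).1 h).1
  rw [h0, envBox_one]
  calc ∑ v ∈ s.filter (fun v : ℤ × ℤ × ℤ => v.1 = (lo : ℤ)), envTerm d lo true e t v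
      ≤ ∑ v ∈ envSq lo K', envTerm d lo true e t v :=
        Finset.sum_le_sum_of_subset_of_nonneg hs fun v _ _ => envTerm_nonneg d lo true e ht v
    _ = ∑ v ∈ envSq lo K' \ envSq lo K, envTerm d lo true e t v + ∑ v ∈ envSq lo K, envTerm d lo true e t v :=
        (Finset.sum_sdiff (envSq_mono (lo : ℤ) hKK')).symm
    _ ≤ envTail2 e K + ∑ v ∈ envSq lo K, envTerm d lo true e t v := by
        have := env_sum_sdiff_envSq_le d lo true he ht (lo : ℤ) hK hKK'
        linarith
    _ = _ := add_comm _ _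

end Summit.AtomisticToContinuum.Crystallization.Theorems.PeriodicWindowsSketch

end
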